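import Mathlib
import Summits.KontsevichZagierPeriods.KontsevichZagierPeriods.Theses.SymplecticScissors
import Literature.NumberTheory.Transcendental.KZCalculusProofs
import Literature.NumberTheory.Transcendental.SemialgebraicMapsProofs

/-!
# `VolumeForm` (stmt-KontsevichZagierPeriods-3814), line `Sketch` — stub `stub_perspectiveMap`

The all-dimension "radial shadow" move of the line: for a base `U ⊆ ℝ^N` and a positive extent
`R` on `U`, the perspective map
`Φ (x', x_N) = (x' / x_N, x_N ^ (N + 1) / (N + 1))` on `{x_N > 0}`
is ONE change-of-variables generator (`KZ.changeOfVariablesRel`, rule (2) of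
[Kontsevich–Zagier 2001, §1.2]) carrying the radial subgraph
`{p | 0 < p_N, p' / p_N ∈ U, p_N < R (p' / p_N)}` with integrand `1` onto the flat subgraph
`{(u, s) | u ∈ U, 0 < s < (R u) ^ (N + 1) / (N + 1)}` with integrand `1`.

The witness, checked against the five fields of `changeOfVariablesRel`:
* `Φ` is `ℚ`-semialgebraic on the source (coordinates `X_i / X_N`, `X_N ≠ 0` there, and
  `X_N ^ (N + 1) / (N + 1)`: `isSemialgebraicFunOn_aeval_div_aeval` + `IsSemialgebraicMapOn.of_forall`);
* `Φ` has the block-upper-triangular derivative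
  `Φ' p = pi (snoc (fun i => p_N⁻¹ • proj i - (p_i / p_N ^ 2) • proj N) (p_N ^ N • proj N))`,
  whose matrix is upper triangular with diagonal `(p_N⁻¹, …, p_N⁻¹, p_N ^ N)`, so `det Φ' = 1`
  (`Matrix.det_of_upperTriangular`);
* `Φ` is injective on `{p_N > 0}` (`p_N = ((N + 1) s) ^ (1 / (N + 1))`, `p_i = u_i p_N`);
* the image is the flat subgraph (`0 < p_N < R u ↔ 0 < p_N ^ (N + 1) / (N + 1) < (R u) ^ (N + 1) / (N + 1)`,
  explicit inverse `(u · t, t)`, `t = ((N + 1) s) ^ (1 / (N + 1))`);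
* `1 = 1 · |1|` on the source.

Sources: M. Kontsevich, D. Zagier, *Periods* (2001), §1.2 rule (2); everything else is calculus
bookkeeping (folklore: cones and gnomonic projections).
-/

noncomputable section

open Set MeasureTheory MvPolynomial
open Literature.NumberTheory.Transcendental

namespace Summit.KontsevichZagierPeriods.SymplecticScissors.VolumeForm

variable {N : ℕ}

/-- The derivative of a quotient of two coordinates `p ↦ p a / p b` at a point with `x b ≠ 0` is
`v ↦ (x b)⁻¹ v a - (x a / x b ^ 2) v b`. [folklore] -/
theorem persp_hasFDerivAt_div (a b : Fin (N + 1)) (x : Fin (N + 1) → ℝ) (hx : x b ≠ 0) :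
    HasFDerivAt (fun p : Fin (N + 1) → ℝ => p a / p b)
      ((x b)⁻¹ • ContinuousLinearMap.proj (R := ℝ) (φ := fun _ : Fin (N + 1) => ℝ) a -
        (x a / x b ^ 2) • ContinuousLinearMap.proj (R := ℝ) (φ := fun _ : Fin (N + 1) => ℝ) b) x := by
  have ha : HasFDerivAt (fun p : Fin (N + 1) → ℝ => p a)
      (ContinuousLinearMap.proj (R := ℝ) (φ := fun _ : Fin (N + 1) => ℝ) a) x := hasFDerivAt_apply a x
  have hb : HasFDerivAt (fun p : Fin (N + 1) → ℝ => p b)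
      (ContinuousLinearMap.proj (R := ℝ) (φ := fun _ : Fin (N + 1) => ℝ) b) x := hasFDerivAt_apply b x
  have hinv : HasFDerivAt (fun p : Fin (N + 1) → ℝ => (p b)⁻¹)
      ((-(x b ^ 2)⁻¹) • ContinuousLinearMap.proj (R := ℝ) (φ := fun _ : Fin (N + 1) => ℝ) b) x :=
    (hasDerivAt_inv hx).comp_hasFDerivAt x hb
  have hmul := ha.mul hinv
  have hfun : (fun p : Fin (N + 1) → ℝ => p a / p b) =
      (fun p : Fin (N + 1) → ℝ => p a) * fun p : Fin (N + 1) → ℝ => (p b)⁻¹ := by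
    funext p
    simp [div_eq_mul_inv]
  rw [hfun]
  refine hmul.congr_fderiv ?_
  ext v
  simp only [_root_.add_apply, _root_.smul_apply, _root_.sub_apply,
    ContinuousLinearMap.proj_apply, smul_eq_mul]
  field_simp
  ring

/-- The derivative of `p ↦ p b ^ (N + 1) / (N + 1)` is `v ↦ (x b) ^ N v b`. [folklore] -/
theorem persp_hasFDerivAt_powDiv (b : Fin (N + 1)) (x : Fin (N + 1) → ℝ) :
    HasFDerivAt (fun p : Fin (N + 1) → ℝ => p b ^ (N + 1) / ((N : ℝ) + 1))
      (x b ^ N • ContinuousLinearMap.proj (R := ℝ) (φ := fun _ : Fin (N + 1) => ℝ) b) x := by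
  have hb : HasFDerivAt (fun p : Fin (N + 1) → ℝ => p b)
      (ContinuousLinearMap.proj (R := ℝ) (φ := fun _ : Fin (N + 1) => ℝ) b) x := hasFDerivAt_apply b x
  have h := ((hasDerivAt_pow (N + 1) (x b)).div_const ((N : ℝ) + 1)).comp_hasFDerivAt x hb
  refine h.congr_fderiv ?_
  ext v
  simp only [_root_.smul_apply, ContinuousLinearMap.proj_apply, smul_eq_mul, Nat.add_sub_cancel]
  have hN : (N : ℝ) + 1 ≠ 0 := Nat.cast_add_one_ne_zero N
  push_cast
  field_simp

/-- The Jacobian of the perspective map, `pi (snoc (fun i => t⁻¹ • proj i - (x_i / t ^ 2) • proj N)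
(t ^ N • proj N))` with `t = x_N ≠ 0`, has determinant `t⁻¹ ^ N · t ^ N = 1`: its matrix is upper
triangular with that diagonal. [folklore] -/
theorem persp_det_eq_one (x : Fin (N + 1) → ℝ) (hx : x (Fin.last N) ≠ 0) :
    (ContinuousLinearMap.pi (Fin.snoc (α := fun _ : Fin (N + 1) => (Fin (N + 1) → ℝ) →L[ℝ] ℝ)
      (fun i : Fin N => (x (Fin.last N))⁻¹ •
          ContinuousLinearMap.proj (R := ℝ) (φ := fun _ : Fin (N + 1) => ℝ) (Fin.castSucc i) -
        (x (Fin.castSucc i) / x (Fin.last N) ^ 2) •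
          ContinuousLinearMap.proj (R := ℝ) (φ := fun _ : Fin (N + 1) => ℝ) (Fin.last N))
      (x (Fin.last N) ^ N •
        ContinuousLinearMap.proj (R := ℝ) (φ := fun _ : Fin (N + 1) => ℝ) (Fin.last N))) :
      (Fin (N + 1) → ℝ) →L[ℝ] (Fin (N + 1) → ℝ)).det = 1 := by
  have hne : ∀ i : Fin N, Fin.last N ≠ Fin.castSucc i := fun i => (Fin.castSucc_ne_last i).symm
  simp only [ContinuousLinearMap.det]
  rw [← LinearMap.det_toMatrix', Matrix.det_of_upperTriangular ?_, Fin.prod_univ_castSucc]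
  · simp only [LinearMap.toMatrix'_apply, ContinuousLinearMap.coe_coe,
      ContinuousLinearMap.pi_apply, Fin.snoc_castSucc, Fin.snoc_last,
      _root_.sub_apply, _root_.smul_apply,
      ContinuousLinearMap.proj_apply, smul_eq_mul, Pi.single_eq_same, Pi.single_apply, hne,
      if_false, mul_one, mul_zero, sub_zero, Finset.prod_const, Finset.card_univ,
      Fintype.card_fin]
    rw [← mul_pow, inv_mul_cancel₀ hx, one_pow]
  · intro k j hjk
    have hjk' : j < k := hjk
    rcases Fin.eq_castSucc_or_eq_last k with ⟨i, rfl⟩ | rfl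
    · have h1 : Fin.castSucc i ≠ j := hjk'.ne'
      have h2 : Fin.last N ≠ j := (hjk'.trans (Fin.castSucc_lt_last i)).ne'
      simp only [LinearMap.toMatrix'_apply, ContinuousLinearMap.coe_coe,
        ContinuousLinearMap.pi_apply, Fin.snoc_castSucc, _root_.sub_apply,
        _root_.smul_apply, ContinuousLinearMap.proj_apply, smul_eq_mul,
        Pi.single_apply, h1, h2, if_false, mul_zero, sub_zero]
    · have h2 : Fin.last N ≠ j := hjk'.ne'
      simp only [LinearMap.toMatrix'_apply, ContinuousLinearMap.coe_coe,
        ContinuousLinearMap.pi_apply, Fin.snoc_last, _root_.smul_apply,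
        ContinuousLinearMap.proj_apply, smul_eq_mul, Pi.single_apply, h2, if_false, mul_zero]

/-- **The perspective move** (stub `stub_perspectiveMap` of `VolumeForm`, line `Sketch`,
stmt-KontsevichZagierPeriods-3814). For a base `U ⊆ ℝ^N`, a positive extent `R` on `U`, a
representation `r` on the radial subgraph `{p | 0 < p_N, p' / p_N ∈ U, p_N < R (p' / p_N)}` and a
representation `r'` on the flat subgraph `{(u, s) | u ∈ U, 0 < s < (R u) ^ (N + 1) / (N + 1)}`, both
with integrand `1` on their domains, `[r] − [r']` is one change-of-variables generator of the
Kontsevich–Zagier calculus, with witness `Φ (x', x_N) = (x' / x_N, x_N ^ (N + 1) / (N + 1))`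
(`|det Φ'| = x_N ^ (-N) · x_N ^ N = 1`). The semialgebraicity hypotheses on `U` and `R` are not
needed for the move itself (the source domain is semialgebraic as a field of `r`).
[Kontsevich–Zagier 2001, §1.2, rule (2)] -/
theorem stub_perspectiveMap : ∀ (N : ℕ) (U : Set (Fin N → ℝ)) (R : (Fin N → ℝ) → ℝ)
    (r r' : KZ.IntegralRep (N + 1)),
    Literature.ModelTheory.ExponentialFields.IsSemialgebraic ℚ U →
    IsSemialgebraicFunOn ℚ U R → (∀ u ∈ U, 0 < R u) →
    r.domain = {p | 0 < p (Fin.last N) ∧ (fun i : Fin N => p (Fin.castSucc i) / p (Fin.last N)) ∈ U ∧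
      p (Fin.last N) < R (fun i : Fin N => p (Fin.castSucc i) / p (Fin.last N))} →
    r'.domain = {q | (fun i : Fin N => q (Fin.castSucc i)) ∈ U ∧ 0 < q (Fin.last N) ∧
      q (Fin.last N) < R (fun i : Fin N => q (Fin.castSucc i)) ^ (N + 1) / (N + 1)} →
    (∀ p ∈ r.domain, r.integrand p = 1) → (∀ q ∈ r'.domain, r'.integrand q = 1) →
    KZ.of r - KZ.of r' ∈ KZ.changeOfVariablesRel := by
  intro N U R r r' _hU _hR hRpos hr hr' hf hf'
  have hN1 : (0 : ℝ) < (N : ℝ) + 1 := Nat.cast_add_one_pos N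
  -- membership in the two domains, unfolded
  have memr : ∀ p, p ∈ r.domain ↔ (0 < p (Fin.last N) ∧
      (fun i : Fin N => p (Fin.castSucc i) / p (Fin.last N)) ∈ U ∧
      p (Fin.last N) < R (fun i : Fin N => p (Fin.castSucc i) / p (Fin.last N))) := fun p => by
    rw [hr]; rfl
  have memr' : ∀ q, q ∈ r'.domain ↔ ((fun i : Fin N => q (Fin.castSucc i)) ∈ U ∧
      0 < q (Fin.last N) ∧
      q (Fin.last N) < R (fun i : Fin N => q (Fin.castSucc i)) ^ (N + 1) / ((N : ℝ) + 1)) :=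
    fun q => by rw [hr']; rfl
  -- the witness and its derivative
  let Φ : (Fin (N + 1) → ℝ) → (Fin (N + 1) → ℝ) := fun p =>
    Fin.snoc (α := fun _ : Fin (N + 1) => ℝ) (fun i : Fin N => p (Fin.castSucc i) / p (Fin.last N))
      (p (Fin.last N) ^ (N + 1) / ((N : ℝ) + 1))
  let Φ' : (Fin (N + 1) → ℝ) → (Fin (N + 1) → ℝ) →L[ℝ] (Fin (N + 1) → ℝ) := fun x =>
    ContinuousLinearMap.pi (Fin.snoc (α := fun _ : Fin (N + 1) => (Fin (N + 1) → ℝ) →L[ℝ] ℝ)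
      (fun i : Fin N => (x (Fin.last N))⁻¹ •
          ContinuousLinearMap.proj (R := ℝ) (φ := fun _ : Fin (N + 1) => ℝ) (Fin.castSucc i) -
        (x (Fin.castSucc i) / x (Fin.last N) ^ 2) •
          ContinuousLinearMap.proj (R := ℝ) (φ := fun _ : Fin (N + 1) => ℝ) (Fin.last N))
      (x (Fin.last N) ^ N •
        ContinuousLinearMap.proj (R := ℝ) (φ := fun _ : Fin (N + 1) => ℝ) (Fin.last N)))
  have hΦc : ∀ p (i : Fin N), Φ p (Fin.castSucc i) = p (Fin.castSucc i) / p (Fin.last N) :=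
    fun p i => Fin.snoc_castSucc (α := fun _ : Fin (N + 1) => ℝ) _ _ i
  have hΦl : ∀ p, Φ p (Fin.last N) = p (Fin.last N) ^ (N + 1) / ((N : ℝ) + 1) :=
    fun p => Fin.snoc_last (α := fun _ : Fin (N + 1) => ℝ) _ _
  -- the Jacobian determinant
  have hdet : ∀ x : Fin (N + 1) → ℝ, x (Fin.last N) ≠ 0 → (Φ' x).det = 1 :=
    fun x hx => persp_det_eq_one x hx
  -- Φ maps the radial subgraph into the flat one
  have hmaps : ∀ p ∈ r.domain, Φ p ∈ r'.domain := by
    intro p hp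
    obtain ⟨hp0, hpU, hpR⟩ := (memr p).1 hp
    rw [memr']
    simp only [hΦc, hΦl]
    refine ⟨hpU, by positivity, ?_⟩
    exact div_lt_div_of_pos_right (pow_lt_pow_left₀ hpR hp0.le (Nat.add_one_ne_zero N)) hN1
  -- Φ is onto the flat subgraph: explicit inverse `(u · t, t)`, `t = ((N + 1) s) ^ (1 / (N + 1))`
  have hsurj : ∀ q ∈ r'.domain, ∃ p ∈ r.domain, Φ p = q := by
    intro q hq
    obtain ⟨hqU, hq0, hqR⟩ := (memr' q).1 hq
    have hRu : 0 < R (fun i : Fin N => q (Fin.castSucc i)) := hRpos _ hqU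
    obtain ⟨t, htpow, ht0⟩ : ∃ t : ℝ, t ^ (N + 1) = ((N : ℝ) + 1) * q (Fin.last N) ∧ 0 < t :=
      ⟨(((N : ℝ) + 1) * q (Fin.last N)) ^ ((N + 1 : ℕ) : ℝ)⁻¹,
        Real.rpow_inv_natCast_pow (by positivity) (Nat.add_one_ne_zero N),
        Real.rpow_pos_of_pos (by positivity) _⟩
    have htR : t < R (fun i : Fin N => q (Fin.castSucc i)) := by
      refine lt_of_pow_lt_pow_left₀ (N + 1) hRu.le ?_
      rw [htpow]
      rw [lt_div_iff₀ hN1] at hqR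
      linarith [hqR]
    refine ⟨Fin.snoc (α := fun _ : Fin (N + 1) => ℝ) (fun i : Fin N => q (Fin.castSucc i) * t) t,
      ?_, ?_⟩
    · rw [memr]
      simp only [Fin.snoc_castSucc, Fin.snoc_last, mul_div_cancel_right₀ _ ht0.ne']
      exact ⟨ht0, hqU, htR⟩
    · funext k
      rcases Fin.eq_castSucc_or_eq_last k with ⟨i, rfl⟩ | rfl
      · rw [hΦc]
        simp only [Fin.snoc_castSucc, Fin.snoc_last]
        exact mul_div_cancel_right₀ _ ht0.ne'
      · rw [hΦl]
        simp only [Fin.snoc_last]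
        rw [htpow]
        exact mul_div_cancel_left₀ _ hN1.ne'
  refine ⟨N + 1, r, r', Φ, Φ', ?_, ?_, ?_, ?_, ?_, rfl⟩
  · -- `Φ` is `ℚ`-semialgebraic on the radial subgraph
    refine IsSemialgebraicMapOn.of_forall r.isSemialgebraic_domain fun j => ?_
    rcases Fin.eq_castSucc_or_eq_last j with ⟨i, rfl⟩ | rfl
    · have hq : ∀ p ∈ r.domain,
          aeval p (X (Fin.last N) : MvPolynomial (Fin (N + 1)) ℚ) ≠ (0 : ℝ) := by
        intro p hp
        rw [aeval_X]
        exact ((memr p).1 hp).1.ne'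
      refine (isSemialgebraicFunOn_aeval_div_aeval r.isSemialgebraic_domain
        (X (Fin.castSucc i)) (X (Fin.last N)) hq).congr ?_
      intro p _
      simp only [aeval_X, hΦc]
    · have hq : ∀ p ∈ r.domain,
          aeval p ((N : MvPolynomial (Fin (N + 1)) ℚ) + 1) ≠ (0 : ℝ) := by
        intro p _
        rw [map_add, map_natCast, map_one]
        exact hN1.ne'
      refine (isSemialgebraicFunOn_aeval_div_aeval r.isSemialgebraic_domain
        (X (Fin.last N) ^ (N + 1)) ((N : MvPolynomial (Fin (N + 1)) ℚ) + 1) hq).congr ?_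
      intro p _
      simp only [map_pow, aeval_X, map_add, map_natCast, map_one, hΦl]
  · -- differentiability within the radial subgraph
    intro x hx
    have hx0 : x (Fin.last N) ≠ 0 := ((memr x).1 hx).1.ne'
    refine HasFDerivAt.hasFDerivWithinAt (hasFDerivAt_pi'' fun k => ?_)
    rcases Fin.eq_castSucc_or_eq_last k with ⟨i, rfl⟩ | rfl
    · rw [ContinuousLinearMap.proj_pi, Fin.snoc_castSucc]
      simp only [hΦc]
      exact persp_hasFDerivAt_div (Fin.castSucc i) (Fin.last N) x hx0
    · rw [ContinuousLinearMap.proj_pi, Fin.snoc_last]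
      simp only [hΦl]
      exact persp_hasFDerivAt_powDiv (Fin.last N) x
  · -- injectivity on the radial subgraph
    intro p hp q hq hpq
    have hp0 : 0 < p (Fin.last N) := ((memr p).1 hp).1
    have hq0 : 0 < q (Fin.last N) := ((memr q).1 hq).1
    have el : p (Fin.last N) ^ (N + 1) / ((N : ℝ) + 1) = q (Fin.last N) ^ (N + 1) / ((N : ℝ) + 1) := by
      rw [← hΦl, ← hΦl, hpq]
    have hl : p (Fin.last N) = q (Fin.last N) := by
      have h : p (Fin.last N) ^ (N + 1) = q (Fin.last N) ^ (N + 1) := (div_left_inj' hN1.ne').1 el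
      exact (pow_left_inj₀ hp0.le hq0.le (Nat.add_one_ne_zero N)).1 h
    funext k
    rcases Fin.eq_castSucc_or_eq_last k with ⟨i, rfl⟩ | rfl
    · have ec : p (Fin.castSucc i) / p (Fin.last N) = q (Fin.castSucc i) / q (Fin.last N) := by
        rw [← hΦc, ← hΦc, hpq]
      rw [hl] at ec
      exact (div_left_inj' hq0.ne').1 ec
    · exact hl
  · -- the image is the flat subgraph
    refine Subset.antisymm (fun q hq => ?_) ?_
    · obtain ⟨p, hp, hpq⟩ := hsurj q hq
      exact ⟨p, hp, hpq⟩
    · rintro _ ⟨p, hp, rfl⟩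
      exact hmaps p hp
  · -- the integrands: `1 = 1 · |1|`
    intro x hx
    rw [hf x hx, hf' _ (hmaps x hx), hdet x ((memr x).1 hx).1.ne', abs_one, mul_one]

end Summit.KontsevichZagierPeriods.SymplecticScissors.VolumeForm

end
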